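import Mathlib
import HarnessLib
import Literature.NumberTheory.Transcendental.KZCalculus
import Literature.NumberTheory.Transcendental.KZSemiCanonicalReductionProofs
import Literature.NumberTheory.Transcendental.KZLogCalculusProofs
import Literature.NumberTheory.Transcendental.KZSemialgebraicComplex
import Literature.NumberTheory.Transcendental.SemialgebraicMapsProofs
import Literature.NumberTheory.Transcendental.KZCubeRational
import Literature.NumberTheory.Transcendental.MZVSimplexRep
import Literature.NumberTheory.Transcendental.KZProductIdeal

/-!
# Route RootDecompZetaThreeFrontier — the two MOVE FACTS under item 28709 `GenusZeroThreeNormalForm` — part 1/2 (`…WordMovesPole`): the pole test on `(0,1)`, Fubini sections of the open ordered simplices `Δ₂`, `Δ₃`, and the two pole templates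

Theorems-split (2 files, sequential imports) of §12a/§12b/§12d/§14 of the decomp-kz lens-1 gen-9 file
`run/shared/lean/pub/decomp-kz/decomp-kz-lens-1/g9/WordLayer.lean` (4228 lines; lens farm rc 0 / 0 err / 0 warn / 0 sorry WITH audit,
standard axioms).  Part 1 is pure analysis over Mathlib and `KZ.openOrderedSimplex`: (i) the POLE TEST `y ↦ M y / y ^ b` (`m ≤ |M|`, `1 ≤ b`)
is not integrable on `(0, η)`; (ii) a.e. sections of an integrable function on `ℝ^{N+1}` in the last (`Fin.snoc`) and in the first (`Fin.cons`)
coordinate are integrable (Fubini through the volume-preserving splittings `MeasurableEquiv.piFinSuccAbove`); (iii) the sections of `Δ₂`, `Δ₃`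
are the intervals `(0, x_last)` / `(x₀, 1)`, of positive volume; (iv) two templates: a function whose every section carries a simple pole `C/t`
at `0` (resp. `C/(1-t)` at `1`) is not integrable on a set of positive volume.  Part 2 proves the route-vocabulary statements `DivergenceLEThree`
and `DualityThree` verbatim.  [Kontsevich–Zagier 2001 §1.2; folklore analysis]  Standard axioms, 0 sorry.
-/

noncomputable section

set_option linter.dupNamespace false

open Set MeasureTheory MvPolynomial
open Literature.NumberTheory.Transcendental
open Literature.ModelTheory.ExponentialFields

namespace Summit.KontsevichZagierPeriods.KontsevichZagierPeriods.Theorems.RootDecompZetaThreeFrontierWordMoves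

/-! ## Membership in `Δ₁`, `Δ₂`, `Δ₃` -/

/-- Every function on `Fin 1` is strictly antitone (vacuously). [folklore] (private: a public twin is landed in `HoffmanSpanInKZ.Negative`) -/
private theorem strictAnti_fin_one (y : Fin 1 → ℝ) : StrictAnti y := fun a b hab =>
  absurd hab (by rw [Subsingleton.elim a b]; exact lt_irrefl _)

/-- Membership in the open ordered simplex `Δ₁ = (0,1)`. [folklore] -/
theorem mem_simplex_one_iff (y : Fin 1 → ℝ) : y ∈ KZ.openOrderedSimplex 1 ↔ 0 < y 0 ∧ y 0 < 1 := by
  constructor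
  · rintro ⟨h0, h1, -⟩
    exact ⟨h0 0, h1 0⟩
  · rintro ⟨h0, h1⟩
    refine ⟨fun i => ?_, fun i => ?_, strictAnti_fin_one y⟩
    · rw [Fin.fin_one_eq_zero i]; exact h0
    · rw [Fin.fin_one_eq_zero i]; exact h1

/-- Membership in `Δ₂`: `0 < z 1 < z 0 < 1`. [folklore] -/
theorem mem_simplex_two_iff (z : Fin 2 → ℝ) :
    z ∈ KZ.openOrderedSimplex 2 ↔ 0 < z 1 ∧ z 1 < z 0 ∧ z 0 < 1 := by
  constructor
  · rintro ⟨h0, h1, ha⟩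
    exact ⟨h0 1, ha (show (0 : Fin 2) < 1 by decide), h1 0⟩
  · rintro ⟨h1, h10, h0⟩
    refine ⟨Fin.forall_fin_two.mpr ⟨h1.trans h10, h1⟩, Fin.forall_fin_two.mpr ⟨h0, h10.trans h0⟩,
      Fin.strictAnti_iff_succ_lt.mpr (Fin.forall_fin_one.mpr ?_)⟩
    simpa using h10

/-- Membership in `Δ₃`: `0 < t 2 < t 1 < t 0 < 1`. [folklore] -/
theorem mem_simplex_three_iff (t : Fin 3 → ℝ) :
    t ∈ KZ.openOrderedSimplex 3 ↔ 0 < t 2 ∧ t 2 < t 1 ∧ t 1 < t 0 ∧ t 0 < 1 := by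
  constructor
  · rintro ⟨h0, h1, ha⟩
    exact ⟨h0 2, ha (show (1 : Fin 3) < 2 by decide), ha (show (0 : Fin 3) < 1 by decide), h1 0⟩
  · rintro ⟨h2, h21, h10, h0⟩
    have hsa : StrictAnti t :=
      Fin.strictAnti_iff_succ_lt.mpr (Fin.forall_fin_two.mpr ⟨by simpa using h10, by simpa using h21⟩)
    exact ⟨fun i => lt_of_lt_of_le h2 (hsa.antitone (Fin.le_last i)),
      fun i => lt_of_le_of_lt (hsa.antitone (Fin.le_iff_val_le_val.2 (Nat.zero_le _))) h0, hsa⟩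

/-! ## The pole test on `(0, η)` and the reflection `y ↦ 1 - y` -/

/-- pole test at `0`: if `m ≤ |M y|` on `(0, η)` with `0 < m`, `0 < η ≤ 1` and `1 ≤ b`, then
`y ↦ M y / y ^ b` is not integrable on `(0, η)` (comparison with `y⁻¹ = y ^ (-1 : ℝ)`). -/
theorem not_integrableOn_pole {M : ℝ → ℝ} {m η : ℝ} {b : ℕ} (hm : 0 < m) (hη : 0 < η)
    (hη1 : η ≤ 1) (hb : 1 ≤ b) (hM : ∀ y ∈ Ioo 0 η, m ≤ |M y|) :
    ¬ IntegrableOn (fun y => M y / y ^ b) (Ioo 0 η) := by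
  intro h
  have hinv : IntegrableOn (fun y : ℝ => y⁻¹) (Ioo 0 η) := by
    refine Integrable.mono' (h.integrable.norm.const_mul m⁻¹) measurable_inv.aestronglyMeasurable
      ((ae_restrict_iff' measurableSet_Ioo).2 (Filter.Eventually.of_forall fun y hy => ?_))
    have hy0 : 0 < y := hy.1
    have hy1 : y ≤ 1 := hy.2.le.trans hη1
    have hyb : y ^ b ≤ y := by simpa using pow_le_pow_of_le_one hy0.le hy1 hb
    have key : m / y ≤ |M y| / y ^ b := div_le_div₀ (abs_nonneg _) (hM y hy) (pow_pos hy0 b) hyb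
    rw [Real.norm_eq_abs, abs_inv, abs_of_pos hy0, Real.norm_eq_abs, abs_div,
      abs_of_pos (pow_pos hy0 b)]
    calc y⁻¹ = m⁻¹ * (m / y) := by field_simp
      _ ≤ m⁻¹ * (|M y| / y ^ b) := mul_le_mul_of_nonneg_left key (inv_nonneg.2 hm.le)
  have h' : IntegrableOn (fun y : ℝ => y ^ (-1 : ℝ)) (Ioo 0 η) :=
    hinv.congr_fun (fun y _ => (Real.rpow_neg_one y).symm) measurableSet_Ioo
  have := (intervalIntegral.integrableOn_Ioo_rpow_iff (s := -1) hη).1 h'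
  exact lt_irrefl _ this

/-- reflection `y ↦ 1 - y` preserves integrability on `(0,1)` (Lebesgue measure is translation- and
negation-invariant). -/
theorem integrableOn_reflect {g : ℝ → ℝ} (hg : IntegrableOn g (Ioo 0 1)) :
    IntegrableOn (fun y => g (1 - y)) (Ioo 0 1) := by
  have hpre : (fun y : ℝ => 1 - y) ⁻¹' Ioo (0:ℝ) 1 = Ioo 0 1 := by
    ext y; simp only [mem_preimage, mem_Ioo]; constructor <;> rintro ⟨h1, h2⟩ <;> constructor <;>
      linarith
  have := (MeasurePreserving.integrableOn_comp_preimage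
    (Measure.measurePreserving_sub_left volume (1:ℝ)) (measurableEmbedding_subLeft (1:ℝ))
    (f := g) (s := Ioo 0 1)).2 hg
  rw [hpre] at this
  exact this

/-- integrability transfer `Δ₁ ⊂ (Fin 1 → ℝ)` → `(0,1) ⊂ ℝ` (`MeasureTheory.volume_preserving_funUnique`) -/
theorem integrableOn_real_of_rep (r : KZ.IntegralRep 1) (F : ℝ → ℝ)
    (hd : r.domain = {t | (∀ i, 0 < t i) ∧ (∀ i, t i < 1) ∧ StrictAnti t})
    (hi : EqOn r.integrand (fun t => F (t 0)) r.domain) : IntegrableOn F (Ioo 0 1) := by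
  have hpre : (MeasurableEquiv.funUnique (Fin 1) ℝ) ⁻¹' Ioo (0:ℝ) 1 = KZ.openOrderedSimplex 1 := by
    ext t
    rw [mem_preimage, mem_simplex_one_iff]
    show t default ∈ Ioo (0:ℝ) 1 ↔ _
    rw [Fin.default_eq_zero]
    exact Iff.rfl
  have hS : MeasurableSet (KZ.openOrderedSimplex 1) :=
    hpre ▸ (MeasurableEquiv.funUnique (Fin 1) ℝ).measurable measurableSet_Ioo
  have hd' : r.domain = KZ.openOrderedSimplex 1 := hd
  have h0 : IntegrableOn r.integrand (KZ.openOrderedSimplex 1) := hd' ▸ r.integrableOn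
  have hi' : EqOn r.integrand (fun t => F (t 0)) (KZ.openOrderedSimplex 1) := hd' ▸ hi
  have h1 : IntegrableOn (fun t : Fin 1 → ℝ => F (t 0)) (KZ.openOrderedSimplex 1) :=
    h0.congr_fun hi' hS
  have h2 : IntegrableOn (F ∘ ⇑(MeasurableEquiv.funUnique (Fin 1) ℝ))
      ((MeasurableEquiv.funUnique (Fin 1) ℝ) ⁻¹' Ioo 0 1) := by
    rw [hpre]
    refine h1.congr_fun (fun t _ => ?_) hS
    show F (t 0) = F (t default)
    rw [Fin.default_eq_zero]
  exact (MeasurePreserving.integrableOn_comp_preimage (volume_preserving_funUnique (Fin 1) ℝ)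
    (MeasurableEquiv.funUnique (Fin 1) ℝ).measurableEmbedding).1 h2

/-! ## Fubini sections in the last (`Fin.snoc`) and first (`Fin.cons`) coordinate -/

/-- `t ↦ Fin.snoc x t` is continuous. [folklore] (verbatim private copy, `Theorems/…SupportCollapse`) -/
private theorem continuous_snoc {N : ℕ} (x : Fin N → ℝ) :
    Continuous fun t : ℝ => (Fin.snoc x t : Fin (N + 1) → ℝ) := by
  refine continuous_pi fun j => ?_
  refine Fin.lastCases ?_ (fun i => ?_) j
  · simpa using continuous_id'
  · simpa using continuous_const

/-- Splitting off the last coordinate, `ℝ^{N+1} ≃ ℝ^N × ℝ`, as a volume-preserving measurable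
equivalence with inverse `(x, t) ↦ Fin.snoc x t`. [folklore] (verbatim private copy) -/
private theorem exists_measurableEquiv_snoc (N : ℕ) :
    ∃ e : (Fin (N + 1) → ℝ) ≃ᵐ (Fin N → ℝ) × ℝ,
      MeasurePreserving e volume ((volume : Measure (Fin N → ℝ)).prod (volume : Measure ℝ)) ∧
      ∀ q, e.symm q = Fin.snoc q.1 q.2 := by
  refine ⟨(MeasurableEquiv.piFinSuccAbove (fun _ => ℝ) (Fin.last N)).trans
    MeasurableEquiv.prodComm, ?_, fun q => ?_⟩
  · refine (volume_preserving_piFinSuccAbove (fun _ => ℝ) (Fin.last N)).trans ?_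
    rw [Measure.volume_eq_prod]
    exact Measure.measurePreserving_swap
  · show (MeasurableEquiv.piFinSuccAbove (fun _ => ℝ) (Fin.last N)).symm (q.2, q.1) = _
    rw [MeasurableEquiv.piFinSuccAbove_symm_apply, Fin.insertNthEquiv_last]
    rfl

/-- `t ↦ Fin.cons t x` is continuous. [folklore] -/
private theorem continuous_cons {N : ℕ} (x : Fin N → ℝ) :
    Continuous fun t : ℝ => (Fin.cons t x : Fin (N + 1) → ℝ) := by
  refine continuous_pi fun j => ?_
  refine Fin.cases ?_ (fun i => ?_) j
  · simpa using continuous_id'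
  · simpa using continuous_const

/-- Splitting off the FIRST coordinate, `ℝ^{N+1} ≃ ℝ × ℝ^N`, volume-preserving, inverse `Fin.cons`. -/
private theorem exists_measurableEquiv_cons (N : ℕ) :
    ∃ e : (Fin (N + 1) → ℝ) ≃ᵐ ℝ × (Fin N → ℝ),
      MeasurePreserving e volume ((volume : Measure ℝ).prod (volume : Measure (Fin N → ℝ))) ∧
      ∀ q, e.symm q = Fin.cons q.1 q.2 := by
  refine ⟨MeasurableEquiv.piFinSuccAbove (fun _ => ℝ) 0, ?_, fun q => ?_⟩
  · have h := volume_preserving_piFinSuccAbove (fun _ : Fin (N + 1) => ℝ) 0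
    rw [Measure.volume_eq_prod] at h
    exact h
  · rw [MeasurableEquiv.piFinSuccAbove_symm_apply, Fin.insertNthEquiv_zero]
    rfl

/-- Fubini: the last-coordinate sections of an integrable function are a.e. integrable. -/
private theorem ae_integrableOn_snoc {N : ℕ} {B : Set (Fin (N + 1) → ℝ)} (hB : MeasurableSet B)
    {f : (Fin (N + 1) → ℝ) → ℝ} (hf : IntegrableOn f B) :
    ∀ᵐ x : Fin N → ℝ, IntegrableOn (fun t : ℝ => f (Fin.snoc x t))
      {t | (Fin.snoc x t : Fin (N + 1) → ℝ) ∈ B} := by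
  obtain ⟨e, he, he_symm⟩ := exists_measurableEquiv_snoc N
  have h1 : Integrable (B.indicator f) volume := (integrable_indicator_iff hB).2 hf
  have h2 : Integrable (B.indicator f ∘ e.symm) ((volume : Measure (Fin N → ℝ)).prod volume) :=
    ((he.symm e).integrable_comp_emb e.symm.measurableEmbedding).2 h1
  refine (h2.prod_right_ae).mono fun x hx => ?_
  have hm : MeasurableSet {t : ℝ | (Fin.snoc x t : Fin (N + 1) → ℝ) ∈ B} :=
    (continuous_snoc x).measurable hB
  refine (integrable_indicator_iff hm).1 (hx.congr (Filter.Eventually.of_forall fun t => ?_))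
  show (B.indicator f ∘ e.symm) (x, t) = _
  rw [Function.comp_apply, he_symm]
  exact (Set.indicator_comp_right (fun t : ℝ => (Fin.snoc x t : Fin (N + 1) → ℝ)) (g := f)).symm

/-- Fubini: the first-coordinate sections of an integrable function are a.e. integrable. -/
private theorem ae_integrableOn_cons {N : ℕ} {B : Set (Fin (N + 1) → ℝ)} (hB : MeasurableSet B)
    {f : (Fin (N + 1) → ℝ) → ℝ} (hf : IntegrableOn f B) :
    ∀ᵐ x : Fin N → ℝ, IntegrableOn (fun t : ℝ => f (Fin.cons t x))
      {t | (Fin.cons t x : Fin (N + 1) → ℝ) ∈ B} := by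
  obtain ⟨e, he, he_symm⟩ := exists_measurableEquiv_cons N
  have h1 : Integrable (B.indicator f) volume := (integrable_indicator_iff hB).2 hf
  have h2 : Integrable (B.indicator f ∘ e.symm) ((volume : Measure ℝ).prod (volume : Measure (Fin N → ℝ))) :=
    ((he.symm e).integrable_comp_emb e.symm.measurableEmbedding).2 h1
  refine (h2.prod_left_ae).mono fun x hx => ?_
  have hm : MeasurableSet {t : ℝ | (Fin.cons t x : Fin (N + 1) → ℝ) ∈ B} :=
    (continuous_cons x).measurable hB
  refine (integrable_indicator_iff hm).1 (hx.congr (Filter.Eventually.of_forall fun t => ?_))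
  show (B.indicator f ∘ e.symm) (t, x) = _
  rw [Function.comp_apply, he_symm]
  exact (Set.indicator_comp_right (fun t : ℝ => (Fin.cons t x : Fin (N + 1) → ℝ)) (g := f)).symm

/-- reflection `u ↦ 1 - u` carries integrability on `(a, 1)` to `(0, 1 - a)` -/
theorem integrableOn_reflect_Ioo {g : ℝ → ℝ} {a : ℝ} (hg : IntegrableOn g (Ioo a 1)) :
    IntegrableOn (fun u => g (1 - u)) (Ioo 0 (1 - a)) := by
  have hpre : (fun u : ℝ => 1 - u) ⁻¹' Ioo a 1 = Ioo 0 (1 - a) := by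
    ext u; simp only [mem_preimage, mem_Ioo]; constructor <;> rintro ⟨h1, h2⟩ <;> constructor <;>
      linarith
  have := (MeasurePreserving.integrableOn_comp_preimage
    (Measure.measurePreserving_sub_left volume (1:ℝ)) (measurableEmbedding_subLeft (1:ℝ))
    (f := g) (s := Ioo a 1)).2 hg
  rw [hpre] at this
  exact this

/-- an a.e. statement failing on a set of positive volume is absurd -/
theorem false_of_ae_of_forall_not {N : ℕ} {P : (Fin N → ℝ) → Prop} (h : ∀ᵐ x : Fin N → ℝ, P x)
    {S : Set (Fin N → ℝ)} (hS : ∀ x ∈ S, ¬ P x) (hvol : volume S ≠ 0) : False := by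
  have h0 : volume {x | ¬ P x} = 0 := ae_iff.1 h
  have hle : volume S ≤ volume {x | ¬ P x} := measure_mono fun x hx => hS x hx
  rw [h0] at hle
  exact hvol (nonpos_iff_eq_zero.1 hle)

/-- A nonempty open ordered simplex has positive volume. [folklore] -/
theorem volume_simplex_ne_zero {N : ℕ} (hne : (KZ.openOrderedSimplex N).Nonempty) :
    volume (KZ.openOrderedSimplex N) ≠ 0 :=
  (KZ.isOpen_openOrderedSimplex N).measure_ne_zero volume hne

/-- `Δ₁` is nonempty (`1/2`). [folklore] -/
theorem simplex_one_nonempty : (KZ.openOrderedSimplex 1).Nonempty :=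
  ⟨fun _ => 1 / 2, (mem_simplex_one_iff _).2 ⟨by norm_num, by norm_num⟩⟩

/-- `Δ₂` is nonempty (`(2/3, 1/3)`). [folklore] -/
theorem simplex_two_nonempty : (KZ.openOrderedSimplex 2).Nonempty :=
  ⟨![2 / 3, 1 / 3], (mem_simplex_two_iff _).2
    ⟨by norm_num [Matrix.cons_val_one, Matrix.head_cons], by norm_num [Matrix.cons_val_one, Matrix.head_cons],
      by norm_num [Matrix.cons_val_zero]⟩⟩

/-! ## The two pole templates and the sections of `Δ₂`, `Δ₃` -/

/-- last-coordinate pole: sections `(0, b x)`, fibre function `C x / t` with `C x ≠ 0` -/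
theorem not_integrableOn_of_snoc_pole {N : ℕ} (F : (Fin (N + 1) → ℝ) → ℝ) (b C : (Fin N → ℝ) → ℝ)
    (hsec : ∀ x ∈ KZ.openOrderedSimplex N,
      {t : ℝ | (Fin.snoc x t : Fin (N + 1) → ℝ) ∈ KZ.openOrderedSimplex (N + 1)} = Ioo 0 (b x))
    (hb : ∀ x ∈ KZ.openOrderedSimplex N, 0 < b x ∧ b x ≤ 1)
    (hFC : ∀ x ∈ KZ.openOrderedSimplex N, ∀ t ∈ Ioo 0 (b x), F (Fin.snoc x t) = C x / t ^ 1)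
    (hC : ∀ x ∈ KZ.openOrderedSimplex N, C x ≠ 0) (hne : (KZ.openOrderedSimplex N).Nonempty) :
    ¬ IntegrableOn F (KZ.openOrderedSimplex (N + 1)) := by
  intro hF
  have hae := ae_integrableOn_snoc (KZ.measurableSet_openOrderedSimplex (N + 1)) hF
  refine false_of_ae_of_forall_not hae (S := KZ.openOrderedSimplex N) (fun x hx h => ?_)
    (volume_simplex_ne_zero hne)
  rw [hsec x hx] at h
  have h' : IntegrableOn (fun t => C x / t ^ 1) (Ioo 0 (b x)) :=
    h.congr_fun (fun t ht => hFC x hx t ht) measurableSet_Ioo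
  exact not_integrableOn_pole (M := fun _ => C x) (abs_pos.2 (hC x hx)) (hb x hx).1 (hb x hx).2 le_rfl
    (fun y _ => le_rfl) h'

/-- first-coordinate pole: sections `(a x, 1)`, fibre function `C x / (1 - t)` with `C x ≠ 0` -/
theorem not_integrableOn_of_cons_pole {N : ℕ} (F : (Fin (N + 1) → ℝ) → ℝ) (a C : (Fin N → ℝ) → ℝ)
    (hsec : ∀ x ∈ KZ.openOrderedSimplex N,
      {t : ℝ | (Fin.cons t x : Fin (N + 1) → ℝ) ∈ KZ.openOrderedSimplex (N + 1)} = Ioo (a x) 1)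
    (ha : ∀ x ∈ KZ.openOrderedSimplex N, 0 ≤ a x ∧ a x < 1)
    (hFC : ∀ x ∈ KZ.openOrderedSimplex N, ∀ t ∈ Ioo (a x) 1, F (Fin.cons t x) = C x / (1 - t) ^ 1)
    (hC : ∀ x ∈ KZ.openOrderedSimplex N, C x ≠ 0) (hne : (KZ.openOrderedSimplex N).Nonempty) :
    ¬ IntegrableOn F (KZ.openOrderedSimplex (N + 1)) := by
  intro hF
  have hae := ae_integrableOn_cons (KZ.measurableSet_openOrderedSimplex (N + 1)) hF
  refine false_of_ae_of_forall_not hae (S := KZ.openOrderedSimplex N) (fun x hx h => ?_)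
    (volume_simplex_ne_zero hne)
  rw [hsec x hx] at h
  have h' : IntegrableOn (fun t => C x / (1 - t) ^ 1) (Ioo (a x) 1) :=
    h.congr_fun (fun t ht => hFC x hx t ht) measurableSet_Ioo
  have h'' : IntegrableOn (fun u => C x / u ^ 1) (Ioo 0 (1 - a x)) :=
    (integrableOn_reflect_Ioo h').congr_fun (fun u _ => by
      show C x / (1 - (1 - u)) ^ 1 = C x / u ^ 1
      rw [sub_sub_cancel]) measurableSet_Ioo
  exact not_integrableOn_pole (M := fun _ => C x) (abs_pos.2 (hC x hx)) (by linarith [(ha x hx).2])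
    (by linarith [(ha x hx).1]) le_rfl (fun y _ => le_rfl) h''

/-- coordinate `0` of `Fin.snoc x t : Fin 2 → ℝ`. [folklore] -/
private theorem snoc_one_zero (x : Fin 1 → ℝ) (t : ℝ) : (Fin.snoc x t : Fin 2 → ℝ) 0 = x 0 := rfl

/-- coordinate `1` of `Fin.snoc x t : Fin 2 → ℝ`. [folklore] -/
private theorem snoc_one_one (x : Fin 1 → ℝ) (t : ℝ) : (Fin.snoc x t : Fin 2 → ℝ) 1 = t := rfl

/-- coordinate `0` of `Fin.snoc x t : Fin 3 → ℝ`. [folklore] -/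
private theorem snoc_two_zero (x : Fin 2 → ℝ) (t : ℝ) : (Fin.snoc x t : Fin 3 → ℝ) 0 = x 0 := rfl

/-- coordinate `1` of `Fin.snoc x t : Fin 3 → ℝ`. [folklore] -/
private theorem snoc_two_one (x : Fin 2 → ℝ) (t : ℝ) : (Fin.snoc x t : Fin 3 → ℝ) 1 = x 1 := rfl

/-- coordinate `2` of `Fin.snoc x t : Fin 3 → ℝ`. [folklore] -/
private theorem snoc_two_two (x : Fin 2 → ℝ) (t : ℝ) : (Fin.snoc x t : Fin 3 → ℝ) 2 = t := rfl

/-- coordinate `0` of `Fin.cons t x : Fin 2 → ℝ`. [folklore] -/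
private theorem cons_one_zero (x : Fin 1 → ℝ) (t : ℝ) : (Fin.cons t x : Fin 2 → ℝ) 0 = t := rfl

/-- coordinate `1` of `Fin.cons t x : Fin 2 → ℝ`. [folklore] -/
private theorem cons_one_one (x : Fin 1 → ℝ) (t : ℝ) : (Fin.cons t x : Fin 2 → ℝ) 1 = x 0 := rfl

/-- coordinate `0` of `Fin.cons t x : Fin 3 → ℝ`. [folklore] -/
private theorem cons_two_zero (x : Fin 2 → ℝ) (t : ℝ) : (Fin.cons t x : Fin 3 → ℝ) 0 = t := rfl

/-- coordinate `1` of `Fin.cons t x : Fin 3 → ℝ`. [folklore] -/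
private theorem cons_two_one (x : Fin 2 → ℝ) (t : ℝ) : (Fin.cons t x : Fin 3 → ℝ) 1 = x 0 := rfl

/-- coordinate `2` of `Fin.cons t x : Fin 3 → ℝ`. [folklore] -/
private theorem cons_two_two (x : Fin 2 → ℝ) (t : ℝ) : (Fin.cons t x : Fin 3 → ℝ) 2 = x 1 := rfl

/-- The last-coordinate section of `Δ₂` over `x ∈ Δ₁` is `(0, x 0)`. [folklore] -/
theorem snoc_section_two {x : Fin 1 → ℝ} (hx : x ∈ KZ.openOrderedSimplex 1) :
    {t : ℝ | (Fin.snoc x t : Fin 2 → ℝ) ∈ KZ.openOrderedSimplex 2} = Ioo 0 (x 0) := by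
  obtain ⟨hx0, hx1⟩ := (mem_simplex_one_iff x).1 hx
  ext t
  rw [mem_setOf_eq, mem_simplex_two_iff, snoc_one_zero, snoc_one_one, mem_Ioo]
  exact ⟨fun h => ⟨h.1, h.2.1⟩, fun h => ⟨h.1, h.2, hx1⟩⟩

/-- The last-coordinate section of `Δ₃` over `x ∈ Δ₂` is `(0, x 1)`. [folklore] -/
theorem snoc_section_three {x : Fin 2 → ℝ} (hx : x ∈ KZ.openOrderedSimplex 2) :
    {t : ℝ | (Fin.snoc x t : Fin 3 → ℝ) ∈ KZ.openOrderedSimplex 3} = Ioo 0 (x 1) := by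
  obtain ⟨hx1, hx10, hx0⟩ := (mem_simplex_two_iff x).1 hx
  ext t
  rw [mem_setOf_eq, mem_simplex_three_iff, snoc_two_zero, snoc_two_one, snoc_two_two, mem_Ioo]
  exact ⟨fun h => ⟨h.1, h.2.1⟩, fun h => ⟨h.1, h.2, hx10, hx0⟩⟩

/-- The first-coordinate section of `Δ₂` over `x ∈ Δ₁` is `(x 0, 1)`. [folklore] -/
theorem cons_section_two {x : Fin 1 → ℝ} (hx : x ∈ KZ.openOrderedSimplex 1) :
    {t : ℝ | (Fin.cons t x : Fin 2 → ℝ) ∈ KZ.openOrderedSimplex 2} = Ioo (x 0) 1 := by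
  obtain ⟨hx0, hx1⟩ := (mem_simplex_one_iff x).1 hx
  ext t
  rw [mem_setOf_eq, mem_simplex_two_iff, cons_one_zero, cons_one_one, mem_Ioo]
  exact ⟨fun h => ⟨h.2.1, h.2.2⟩, fun h => ⟨hx0, h.1, h.2⟩⟩

/-- The first-coordinate section of `Δ₃` over `x ∈ Δ₂` is `(x 0, 1)`. [folklore] -/
theorem cons_section_three {x : Fin 2 → ℝ} (hx : x ∈ KZ.openOrderedSimplex 2) :
    {t : ℝ | (Fin.cons t x : Fin 3 → ℝ) ∈ KZ.openOrderedSimplex 3} = Ioo (x 0) 1 := by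
  obtain ⟨hx1, hx10, hx0⟩ := (mem_simplex_two_iff x).1 hx
  ext t
  rw [mem_setOf_eq, mem_simplex_three_iff, cons_two_zero, cons_two_one, cons_two_two, mem_Ioo]
  exact ⟨fun h => ⟨h.2.2.1, h.2.2.2⟩, fun h => ⟨hx1, hx10, h.1, h.2⟩⟩

end Summit.KontsevichZagierPeriods.KontsevichZagierPeriods.Theorems.RootDecompZetaThreeFrontierWordMoves
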